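import Literature.Analysis.FluidPDE.TransversePullback
import HarnessLib

/-!
# Pull-backs along arbitrary integer transverse forms of a lattice direction (no orthogonality),
# and the single-geodesic datum of a unimodular completion

Analysis/FluidPDE support file on the discharge path of `Torus.DeLellisKwon2022_thm11`
(everything proved; no named facts). The Mikado profiles of De Lellis–Kwon, Anal. PDE 15 (2022) =
arXiv:2006.06482, §3 ("`U_f = f ψ_f` for some smooth `ψ_f` with `f·∇ψ_f = 0`", supported in a thin
tube around the closed geodesic `l_f` of direction `f ∈ ℤ³`, (3.6)) are needed for 270 directions
`f` (`DLK.dir`, `MikadoDirectionFamilies`), almost none of which admits ORTHOGONAL integer transverse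
forms with an integer section — the hypothesis `orth` of the tree's `TransverseDatum`
(`TransversePullback`, built for the Cheskidov–Luo directions `e_i, e_i ± 2e_j` and needed there
only for the weighted-Laplacian formula `laplacian_pull`). This file records the orthogonality-free
part of that theory:

* `LineDatum d m` — integer forms `A : d → m → ℤ` annihilating a direction `k : d → ℤ`, with an
  integer section `B` (`BA = 1`); every `TransverseDatum` is one (`TransverseDatum.toLineDatum`);
* `LineDatum.hom` (`L : 𝕋^d →+ 𝕋^m`, continuous, surjective), `LineDatum.lin` (the real-linear
  lift, `L ∘ proj = proj ∘ L̃`), `LineDatum.pull G = G ∘ L` with: smoothness, the chain rule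
  `D(G ∘ L)(x) = DG(Lx) ∘ L̃`, **invariance along `k`** (`fderiv_pull_dir`,
  `sum_mul_partialDeriv_pull`: `∑ₗ kₗ ∂ₗ(G ∘ L) = 0` — DLK's `f·∇ψ_f = 0`), `∂ₗ(G ∘ L)`, measure
  preservation and `∫_{𝕋^d} (G ∘ L) = ∫_{𝕋^m} G` (so all moments `⟨ψ⟩, ⟨ψ²⟩, ⟨ψ³⟩` of pulled-back
  profiles are those of `G`, cf. DLK (3.5));
* `LineDatum.ofUnimodular` — for `d = 3`, `m = 2`: from an integer matrix `M` with integer inverse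
  `N` (`MN = NM = 1`; rows `θ₀, θ₁, θ₂` of `M`), the datum with forms `θ₀, θ₁`, direction `k` = the
  last column of `N`, section = the first two columns of `N`. (The remaining geometric facts — the
  kernel of `L` is exactly the closed geodesic of direction `k`, and pull-backs of profiles
  supported near `0 ∈ 𝕋²` are supported in a tube around it — are the subject of a sequel.)

The proofs are those of `TransversePullback` verbatim, minus orthogonality.

## References

* C. De Lellis, H. Kwon, Anal. PDE 15 (2022) = arXiv:2006.06482, §3 (Mikado flows `U_f = f ψ_f`,
  `f·∇ψ_f = 0`, (3.5), (3.6)). [DelellisKwon2022]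
* A. Cheskidov, X. Luo, Invent. Math. 229 (2022) = arXiv:2009.06596, §4.1 (the pull-back device).
  [CheskidovLuo2022]
-/

noncomputable section

open Set Filter Topology Function MeasureTheory
open scoped ContDiff

namespace Literature.Analysis.FluidPDE

open FunctionSpaces FunctionSpaces.Torus

/-- **Integer transverse data of a lattice direction, without orthogonality**: integer forms `A`
(the map `(L y)_{l'} = ∑ₗ A l l' yₗ`), the direction `k` annihilated by the forms, and an integer
section `B` with `BA = 1`. [folklore] -/
structure LineDatum (d m : Type*) [Fintype d] [Fintype m] [DecidableEq m] where
  /-- the integer transverse forms (columns) -/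
  A : d → m → ℤ
  /-- the lattice direction -/
  k : d → ℤ
  /-- an integer section -/
  B : m → d → ℤ
  /-- The forms annihilate the direction. -/
  annih : ∀ l' : m, ∑ l, A l l' * k l = 0
  /-- `B A = 1`. -/
  rightInv : ∀ l' l'' : m, ∑ l, B l' l * A l l'' = if l' = l'' then 1 else 0

/-- Every `TransverseDatum` is a `LineDatum` (forget the weights and the orthogonality). [folklore] -/
def TransverseDatum.toLineDatum {d m : Type*} [Fintype d] [Fintype m] [DecidableEq m]
    (T : TransverseDatum d m) : LineDatum d m where
  A := T.A
  k := T.k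
  B := T.B
  annih := T.annih
  rightInv := T.rightInv

namespace LineDatum

variable {d m : Type*} [Fintype d] [Fintype m] [DecidableEq m]
variable (T : LineDatum d m)

/-- The transverse map `L : 𝕋^d → 𝕋^m`, `(L y)_{l'} = ∑ₗ A l l' • yₗ`, a group homomorphism. [folklore] -/
def hom : UnitAddTorus d →+ UnitAddTorus m where
  toFun y := fun l' => ∑ l, T.A l l' • y l
  map_zero' := by funext l'; simp
  map_add' y y' := by funext l'; simp [Finset.sum_add_distrib]

/-- Unfolding `L`. [folklore] -/
theorem hom_apply (y : UnitAddTorus d) (l' : m) : T.hom y l' = ∑ l, T.A l l' • y l := rfl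

/-- `L` is continuous. [folklore] -/
theorem continuous_hom : Continuous T.hom := by
  refine continuous_pi fun l' => ?_
  simp only [hom_apply]
  exact continuous_finsetSum _ fun l _ => (continuous_zsmul _).comp (continuous_apply l)

/-- The real-linear lift `L̃ : ℝ^d → ℝ^m`, `(L̃ v)_{l'} = ∑ₗ A l l' vₗ`. [folklore] -/
def lin : EuclideanSpace ℝ d →L[ℝ] EuclideanSpace ℝ m :=
  LinearMap.toContinuousLinearMap
    { toFun := fun v => WithLp.toLp 2 fun l' => ∑ l, (T.A l l' : ℝ) * v l
      map_add' := fun v w => by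
        ext l'; simp [Finset.sum_add_distrib, mul_add]
      map_smul' := fun a v => by
        ext l'; simp [Finset.mul_sum, mul_left_comm] }

/-- Unfolding `L̃`. [folklore] -/
theorem lin_apply (v : EuclideanSpace ℝ d) (l' : m) : T.lin v l' = ∑ l, (T.A l l' : ℝ) * v l := rfl

/-- **`L ∘ proj = proj ∘ L̃`** (integer coefficients descend to the torus). [folklore] -/
theorem hom_proj (y : EuclideanSpace ℝ d) : T.hom (proj y) = proj (T.lin y) := by
  funext l'
  rw [hom_apply, proj_apply, lin_apply, TransverseDatum.coe_sum_unitAddCircle]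
  refine Finset.sum_congr rfl fun l _ => ?_
  rw [proj_apply, ← zsmul_eq_mul, AddCircle.coe_zsmul]

/-- `L` is onto (the integer section `B` provides preimages). [folklore] -/
theorem hom_surjective : Surjective T.hom := by
  intro z
  refine ⟨fun l => ∑ l', T.B l' l • z l', funext fun l'' => ?_⟩
  rw [hom_apply]
  simp only [Finset.smul_sum, smul_smul]
  rw [Finset.sum_comm]
  have : ∀ l', ∑ l, (T.A l l'' * T.B l' l) • z l' = (if l' = l'' then (1 : ℤ) else 0) • z l' := fun l' => by
    rw [← Finset.sum_smul, ← T.rightInv l' l'']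
    exact congrArg (· • z l') (Finset.sum_congr rfl fun l _ => mul_comm _ _)
  simp only [this, ite_smul, one_smul, zero_smul, Finset.sum_ite_eq', Finset.mem_univ, if_true]

/-- The direction as a real vector `k̃ ∈ ℝ^d`. [folklore] -/
def dirVec : EuclideanSpace ℝ d := WithLp.toLp 2 fun l => (T.k l : ℝ)

/-- Unfolding `dirVec`. [folklore] -/
theorem dirVec_apply (l : d) : T.dirVec l = (T.k l : ℝ) := rfl

/-- `L̃ k̃ = 0`: the forms annihilate the direction. [folklore] -/
theorem lin_dirVec : T.lin T.dirVec = 0 := by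
  ext l'
  rw [lin_apply]
  simp only [PiLp.zero_apply, dirVec_apply]
  have := T.annih l'
  exact_mod_cast this

/-! ## Pull-back of functions along `L` -/

variable {F : Type*}

/-- The pull-back `G ∘ L` of a function on `𝕋^m` to `𝕋^d`. [folklore] -/
def pull (G : UnitAddTorus m → F) : UnitAddTorus d → F := G ∘ T.hom

/-- Unfolding `pull`. [folklore] -/
theorem pull_apply (G : UnitAddTorus m → F) (y : UnitAddTorus d) : T.pull G y = G (T.hom y) := rfl

/-- `lift (G ∘ L) = lift G ∘ L̃`. [folklore] -/
theorem lift_pull (G : UnitAddTorus m → F) : lift (T.pull G) = lift G ∘ T.lin := by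
  funext y
  simp only [lift_apply, comp_apply, pull_apply, hom_proj]

/-- `liftAt (G ∘ L) x = liftAt G (L x) ∘ L̃` (`L` is additive). [folklore] -/
theorem liftAt_pull (G : UnitAddTorus m → F) (x : UnitAddTorus d) :
    liftAt (T.pull G) x = liftAt G (T.hom x) ∘ T.lin := by
  funext v
  simp only [liftAt_apply, comp_apply, pull_apply, map_add, hom_proj]

/-- The support of a pull-back is the preimage of the support. [folklore] -/
theorem support_pull [Zero F] (G : UnitAddTorus m → F) : Function.support (T.pull G) = T.hom ⁻¹' Function.support G :=
  rfl

/-- Pull-backs of nonzero values come from the support of `G`: `(G ∘ L) y ≠ 0 → G (L y) ≠ 0`. [folklore] -/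
theorem apply_hom_ne_zero_of_pull_ne_zero [Zero F] {G : UnitAddTorus m → F} {y : UnitAddTorus d}
    (h : T.pull G y ≠ 0) : G (T.hom y) ≠ 0 :=
  h

variable [NormedAddCommGroup F] [NormedSpace ℝ F]

/-- Pull-backs of smooth functions are smooth. [folklore] -/
theorem isSmooth_pull {G : UnitAddTorus m → F} (hG : IsSmooth G) : IsSmooth (T.pull G) := by
  unfold IsSmooth
  rw [lift_pull]
  exact hG.comp T.lin.contDiff

/-- Pull-backs of `C^n` functions are `C^n`. [folklore] -/
theorem isContDiff_pull {n : WithTop ℕ∞} {G : UnitAddTorus m → F} (hG : IsContDiff n G) : IsContDiff n (T.pull G) := by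
  unfold IsContDiff
  rw [lift_pull]
  exact hG.comp T.lin.contDiff

/-- **Chain rule**: `D(G ∘ L)(x) = DG(L x) ∘ L̃`. [folklore] -/
theorem fderiv_pull {G : UnitAddTorus m → F} (hG : IsContDiff 1 G) (x : UnitAddTorus d) :
    Torus.fderiv (T.pull G) x = (Torus.fderiv G (T.hom x)).comp T.lin := by
  rw [Torus.fderiv, Torus.fderiv, liftAt_pull]
  have hd : DifferentiableAt ℝ (liftAt G (T.hom x)) (T.lin 0) := by
    rw [map_zero]
    exact ((hG.liftAt _).differentiable one_ne_zero) _
  rw [fderiv_comp 0 hd T.lin.differentiableAt, T.lin.fderiv, map_zero]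

/-- **Directional invariance**: `D(G ∘ L)(x) k̃ = 0` — the pulled-back profile is constant along the
direction (DLK: "`U_f = f ψ_f` ... with `f·∇ψ_f = 0`"). [cite: DelellisKwon2022, §3 (f·∇ψ_f = 0)] -/
theorem fderiv_pull_dir {G : UnitAddTorus m → F} (hG : IsContDiff 1 G) (x : UnitAddTorus d) :
    Torus.fderiv (T.pull G) x T.dirVec = 0 := by
  rw [fderiv_pull T hG, ContinuousLinearMap.comp_apply, lin_dirVec, map_zero]

/-- `∂ₗ (G ∘ L) (x) = ∑_{l'} A l l' ∂_{l'} G (L x)`. [folklore] -/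
theorem partialDeriv_pull [DecidableEq d] {G : UnitAddTorus m → F} (hG : IsContDiff 1 G) (l : d) (x : UnitAddTorus d) :
    partialDeriv l (T.pull G) x = ∑ l', (T.A l l' : ℝ) • partialDeriv l' G (T.hom x) := by
  rw [partialDeriv_eq_fderiv_apply (T.isContDiff_pull hG) l x, fderiv_pull T hG, ContinuousLinearMap.comp_apply,
    fderiv_apply_eq_sum_partialDeriv hG]
  refine Finset.sum_congr rfl fun l' _ => ?_
  rw [lin_apply]
  congr 1
  simp [Finset.sum_ite_eq']

/-- **`k·∇(G ∘ L) = 0`** in coordinates: `∑ₗ kₗ ∂ₗ (G ∘ L) (x) = 0` (the form in which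
`f·∇ψ_f = 0` enters `div U_f = 0` and `(U_f·∇)U_f = 0`). [cite: DelellisKwon2022, §3 (f·∇ψ_f = 0)] -/
theorem sum_smul_partialDeriv_pull [DecidableEq d] {G : UnitAddTorus m → F} (hG : IsContDiff 1 G) (x : UnitAddTorus d) :
    ∑ l, (T.k l : ℝ) • partialDeriv l (T.pull G) x = 0 := by
  have h := T.fderiv_pull_dir hG x
  rw [fderiv_apply_eq_sum_partialDeriv (T.isContDiff_pull hG)] at h
  simpa [dirVec_apply] using h

/-- Scalar form of the invariance: `∑ₗ kₗ ∂ₗψ(x) = 0` for `ψ = G ∘ L` real valued. [cite: DelellisKwon2022, §3 (f·∇ψ_f = 0)] -/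
theorem sum_mul_partialDeriv_pull [DecidableEq d] {G : UnitAddTorus m → ℝ} (hG : IsContDiff 1 G) (x : UnitAddTorus d) :
    ∑ l, (T.k l : ℝ) * partialDeriv l (T.pull G) x = 0 := by
  simpa [smul_eq_mul] using T.sum_smul_partialDeriv_pull hG x

/-! ## `L` preserves the Haar probability measures -/

/-- **`L_* vol_{𝕋^d} = vol_{𝕋^m}`** (continuous surjective homomorphism of compact groups). [folklore] -/
theorem map_hom_volume : Measure.map T.hom (volume : Measure (UnitAddTorus d)) = volume := by
  have hm : Measurable T.hom := T.continuous_hom.measurable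
  haveI : (Measure.map T.hom (volume : Measure (UnitAddTorus d))).IsAddHaarMeasure :=
    Measure.isAddHaarMeasure_map_of_isFiniteMeasure (volume : Measure (UnitAddTorus d)) T.hom
      T.continuous_hom T.hom_surjective
  haveI : IsProbabilityMeasure (Measure.map T.hom (volume : Measure (UnitAddTorus d))) :=
    Measure.isProbabilityMeasure_map hm.aemeasurable
  exact Measure.isAddHaarMeasure_eq_of_isProbabilityMeasure _ _

/-- `L` is measure preserving between the Haar probability measures. [folklore] -/
theorem measurePreserving_hom : MeasurePreserving T.hom (volume : Measure (UnitAddTorus d)) volume :=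
  ⟨T.continuous_hom.measurable, T.map_hom_volume⟩

/-- **Integrals of pull-backs**: `∫_{𝕋^d} G(L y) dy = ∫_{𝕋^m} G(z) dz` — the moments
`⟨ψ⟩, ⟨ψ²⟩, ⟨ψ³⟩` of a pulled-back profile are those of `G` (DLK (3.5)). [cite: DelellisKwon2022, §3.1 (3.5)] -/
theorem integral_pull {E : Type*} [NormedAddCommGroup E] [NormedSpace ℝ E] (G : UnitAddTorus m → E)
    (hG : AEStronglyMeasurable G volume) : ∫ y, T.pull G y = ∫ z, G z := by
  have h := integral_map (μ := (volume : Measure (UnitAddTorus d))) T.continuous_hom.measurable.aemeasurable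
    (f := G) (by rw [T.map_hom_volume]; exact hG)
  rw [T.map_hom_volume] at h
  rw [h]
  rfl

/-- Moments of pulled-back real profiles: `∫ (G ∘ L)^p = ∫ G^p` for continuous `G`. [cite: DelellisKwon2022, §3.1 (3.5)] -/
theorem integral_pull_pow {G : UnitAddTorus m → ℝ} (hG : Continuous G) (p : ℕ) :
    ∫ y, T.pull G y ^ p = ∫ z, G z ^ p := by
  have : (fun y => T.pull G y ^ p) = T.pull fun z => G z ^ p := rfl
  rw [this]
  exact T.integral_pull _ (hG.pow p).aestronglyMeasurable

end LineDatum

/-! ## The datum of a unimodular completion (`d = 3`, `m = 2`) -/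

namespace LineDatum

/-- **The line datum of a unimodular integer matrix**: given `M, N ∈ ℤ^{3×3}` with `N M = 1` and
`M N = 1` (rows `θ₀, θ₁, θ₂` of `M`), the forms are `θ₀, θ₁` (`A l l' = M l' l`), the direction is
the last column of `N` (`k l = N l 2`, so `θᵢ·k = (MN)ᵢ₂ = 0` for `i = 0,1`), and the section is
`B l' l = N l l'` (`∑ₗ N l l' M l'' l = (MN)_{l'' l'} = δ`). For a primitive `f ∈ ℤ³` a unimodular
`M` with `N e₂ = f` exists (extended Euclid), and the kernel of the resulting `L` is the single
closed geodesic of direction `f` (sequel). [folklore] -/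
def ofUnimodular (M N : Matrix (Fin 3) (Fin 3) ℤ) (hMN : M * N = 1) : LineDatum (Fin 3) (Fin 2) where
  A l l' := M (Fin.castSucc l') l
  k l := N l 2
  B l' l := N l (Fin.castSucc l')
  annih l' := by
    have h := congrFun (congrFun hMN (Fin.castSucc l')) 2
    rw [Matrix.mul_apply, Matrix.one_apply, if_neg (by fin_cases l' <;> decide)] at h
    simpa using h
  rightInv l' l'' := by
    have h := congrFun (congrFun hMN (Fin.castSucc l'')) (Fin.castSucc l')
    rw [Matrix.mul_apply, Matrix.one_apply] at h
    simp only [Fin.castSucc_inj] at h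
    have h' : ∑ l, N l (Fin.castSucc l') * M (Fin.castSucc l'') l = if l'' = l' then 1 else 0 := by
      rw [← h]
      exact Finset.sum_congr rfl fun l _ => by ring
    rw [h']
    by_cases hll : l' = l''
    · subst hll; simp
    · rw [if_neg hll, if_neg (Ne.symm hll)]

/-- The direction of `ofUnimodular M N` is the last column of `N`. [folklore] -/
@[simp] theorem ofUnimodular_k (M N : Matrix (Fin 3) (Fin 3) ℤ) (hMN : M * N = 1) (l : Fin 3) :
    (ofUnimodular M N hMN).k l = N l 2 := rfl

/-- The forms of `ofUnimodular M N` are the first two rows of `M`. [folklore] -/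
@[simp] theorem ofUnimodular_A (M N : Matrix (Fin 3) (Fin 3) ℤ) (hMN : M * N = 1) (l : Fin 3) (l' : Fin 2) :
    (ofUnimodular M N hMN).A l l' = M (Fin.castSucc l') l := rfl

end LineDatum

end Literature.Analysis.FluidPDE
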